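import Literature.MathematicalPhysics.QuantumFieldTheory.Balaban1983to89.T4HistoryLipschitzRecursion

/-!
# NE9EvaluationChannel — the STRUCTURE leaves of the NE9-P2 skeleton for the localization channel DISCHARGED for every
EVALUATION–INTEGRAL channel, and the per-creation-step size leaf reduced to ONE kernel-mass inequality (cell `pub-balaban`,
T4-DAG §2 node U3 / §6 NE9; lineage t4-ne9-p2 = prover P2 «inductive route», generation 19; task F2 of the ROUND-2 skeleton
`HOME/t4/skeletons/NE9-t4-ne9-p2.md` §4 — leaves L02/L03/L06)

HONEST FRAMING (T4-DAG PAGE 1).  Rung (B)+1 on a FIXED finite torus — NOT infinite volume, NOT a mass gap, NOT the Clay problem.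
NE9 (`T4OutputRate.NE9` ∧ `FadingMemory`) is a cell NEW ESTIMATE, NOT PRINTED, and is NOT discharged here.  Everything below is
bookkeeping over the ABSTRACT carriers of `T4OutputRate`; the one analytic input (the kernel-mass inequality) is a DISPLAYED
binder.  [I] = [Balaban1987RG1], [II] = [Balaban1988RG2Cluster] are quoted for TYPES only (ABSOLUTE RULE).  `FlowStep.BetaPertH`,
(B), (B^μ) do not occur.

WHERE THIS SITS.  The lineage's recursion-side end-to-end theorem
`T4HistoryLipschitzRecursion.ne9_and_fadingMemory_of_perStepNN` displays, about the step-k localization channel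
`T : ℕ → (ℕ → ℝ) → (Bg → C.Dom → ℝ) → ι → ℝ` (old terms ↦ fluctuation potentials {𝐕′_k(Y,·)}, [II] (1.33) p. 9), FOUR printed-
STRUCTURE binders — `AdmissibleTerms E W Adm` + `AdmRestrict Adm` (a linear admissible class closed under scale surgery),
`ChannelAdditive Adm T` ((1.33) is a sum of term-by-term operations (1.10)/(1.23)), `ChannelStepSum Adm T` (⇐ `ChannelLocal`,
the step-k channel reads creation steps ≤ k) — and ONE size binder `ChannelSizeAtStepNN Adm T κ wt τ` (the per-creation-step
reading of [II] Lemma 1 (1.36) with the pre-summation factor of p. 8, XREAD-SUPPORTED C-pv15g8-3).  Print's (1.23) p. 7 is an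
EVALUATION–INTEGRAL operation on ONE old term: Cauchy integrals in `t_□`, `σ(Δ)` of the term evaluated at parameter-dependent
backgrounds — «(1/2πi)∫dt_□/t_□² ∏_{Δ⊂Y₀∖□̃⁴}∫ds(Δ)(1/2πi)∫dσ(Δ)/(σ(Δ)−s(Δ))² · 𝐄(□₀,(tζ̃_□ + t_□ζ_□)𝐇_k(σ(Y₀), B′))» (the
t_□- and σ(Δ)-integrations run over circles, p. 7: «over the circle (1.22)», «|σ(Δ)| = e^{κ₁}») — summed over «all admissible
□₀, Y₀, j and X» (p. 7).  [DOCFIX v1.0.1 (XREAD t4-ne9-p3, CLAIMS.log l.5653, C-ne9p3-3): v1 wrote «∮» for print's «∫» and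
misplaced one parenthesis in «𝐇_k(σ(Y₀), B′)»; glyph-level, statements unchanged.]  THIS LEAF types that FORM: `evalChannel F ν w bg k s H y = Σ_{X ∈ F k s y} ∫ w k s y X ω ·
H (bg k s y X ω) X ∂(ν k s y X)` (a finite set of source domains, real weights, parametrised backgrounds, one parameter measure
each), and PROVES the four structure binders for it (admissible class := integrability along the evaluation families;
locality := the source domains have creation step ≤ k), and the size binder FROM ONE KERNEL-MASS INEQUALITY
`Σ_{X ∈ F k s y, scale X = j} e^{−κd(X)}·∫|w k s y X| ∂ν ≤ wt k y·τ k j` (TYPE: (1.24) p. 7 «|(1.23)| ≤ 8B₀C₁e^{16κ₁}α₂^{−1}g_k|B|E₀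
(α₁/α₃)⁵(L^jη)⁵·exp(−(κ₁−1)M^{−4}|Y₀∖□̃⁴|)exp(−κd_j(X))» = weight mass × the term's size, the E₀-FREE combinatorial sums (1.25)–(1.28)
p. 7–8, and p. 8 l. 9–10 «This yields (6L)⁴L^jη, and the sum over j is bounded by 2(6L)⁴»).  End-to-end:
`ne9_and_fadingMemory_of_evalChannel` = `ne9_and_fadingMemory_of_perStepNN` with the five channel binders replaced by:
integrability of the terms along the families, of the weights, the locality of the source domains, and the kernel mass.
NOT PRINTED and not claimed: that Bałaban's (1.33) IS such an operator with THESE masses (an instantiation, task O1), and the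
per-creation-step reading itself (G-ne9p2-4, SUPPORTED).  DISGUISE TEST: every statement here is about ONE term collection `H`
(one history); nothing compares two histories.

WHAT IS PROVED (kernel, `[folklore]` bookkeeping; 0 sorry).
§1 `evalChannel`, `EvalAdm` (defs); `evalAdm_sub`, `admissibleTerms_eval`, `admRestrict_eval`, `channelAdditive_eval`,
   `channelLocal_eval`, `channelStepSum_eval`.
§2 `abs_integral_mul_le_mass` (|∫ w·f| ≤ (∫|w|)·B for |f| ≤ B), **`channelSizeAtStepNN_of_kernelMass`**, `channelSizeNN_eval`.
§3 **`ne9_and_fadingMemory_of_evalChannel`** (END, recursion side).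
§4 non-vacuity: the sibling toy channel `T4HistoryLipschitzRecursion.toyChannel k s H () = H () k` IS an evaluation channel
   (`toyChannel_eq_evalChannel`: one source domain, Dirac parameter measure, weight 1) and its kernel mass is `[j = k]`.

References (TYPES only): [Balaban1988RG2Cluster] CMP 116 (1988) (1.10)/(1.23)–(1.29) pp. 6–8, Lemma 1 (1.33)–(1.36) p. 9;
[Balaban1987RG1] CMP 109 (1987) (0.23) p. 256, (2.12)–(2.13) p. 268.
-/

noncomputable section

namespace Summit.QuantumFields.BalabanUV.T4Continuum.NE9EvaluationChannel

open scoped BigOperators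
open MeasureTheory
open Literature.MathematicalPhysics.QuantumFieldTheory.Balaban1983to89
open Literature.MathematicalPhysics.QuantumFieldTheory.Balaban1983to89.T4OutputRate
open Literature.MathematicalPhysics.QuantumFieldTheory.Balaban1983to89.T4HistoryLipschitzRecursion

variable {C : Carriers} {Bg ι : Type} {Ω : Type*} [MeasurableSpace Ω]

/-! ## §1 The evaluation–integral channel and its structure binders -/

/-- **THE EVALUATION–INTEGRAL CHANNEL** (the FORM of [II] (1.10)/(1.23) p. 6–7 summed as in (1.33) p. 9): at step `k`, comparison
history `s`, output index `y`, the channel output of a term collection `H` is a finite sum over SOURCE domains `X ∈ F k s y` of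
integrals, against a parameter measure `ν k s y X`, of a real weight `w k s y X ω` times the term `H` EVALUATED at a
parameter-dependent background `bg k s y X ω` on the domain `X`.  LINEAR in `H` by construction. [folklore] -/
def evalChannel (F : ℕ → (ℕ → ℝ) → ι → Finset C.Dom) (ν : ℕ → (ℕ → ℝ) → ι → C.Dom → Measure Ω)
    (w : ℕ → (ℕ → ℝ) → ι → C.Dom → Ω → ℝ) (bg : ℕ → (ℕ → ℝ) → ι → C.Dom → Ω → Bg) :
    ℕ → (ℕ → ℝ) → (Bg → C.Dom → ℝ) → ι → ℝ :=
  fun k s H y => ∑ X ∈ F k s y, ∫ ω, w k s y X ω * H (bg k s y X ω) X ∂(ν k s y X)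

/-- **THE ADMISSIBLE CLASS OF AN EVALUATION CHANNEL**: term collections integrable along every evaluation family (in print: the
terms are analytic, hence continuous, on the spaces (1.17)/(1.34) and the families stay inside them — [II] p. 7 «All terms (1.23)
with the localization domain Y are defined and analytic on this space.»). [folklore] -/
def EvalAdm (F : ℕ → (ℕ → ℝ) → ι → Finset C.Dom) (ν : ℕ → (ℕ → ℝ) → ι → C.Dom → Measure Ω)
    (w : ℕ → (ℕ → ℝ) → ι → C.Dom → Ω → ℝ) (bg : ℕ → (ℕ → ℝ) → ι → C.Dom → Ω → Bg) : Set (Bg → C.Dom → ℝ) :=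
  {H | ∀ (k : ℕ) (s : ℕ → ℝ) (y : ι), ∀ X ∈ F k s y,
    Integrable (fun ω => w k s y X ω * H (bg k s y X ω) X) (ν k s y X)}

variable {F : ℕ → (ℕ → ℝ) → ι → Finset C.Dom} {ν : ℕ → (ℕ → ℝ) → ι → C.Dom → Measure Ω}
  {w : ℕ → (ℕ → ℝ) → ι → C.Dom → Ω → ℝ} {bg : ℕ → (ℕ → ℝ) → ι → C.Dom → Ω → Bg}

/-- Membership in the admissible class, unfolded. [folklore] -/
theorem mem_evalAdm {H : Bg → C.Dom → ℝ} :
    H ∈ EvalAdm F ν w bg ↔ ∀ (k : ℕ) (s : ℕ → ℝ) (y : ι), ∀ X ∈ F k s y,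
      Integrable (fun ω => w k s y X ω * H (bg k s y X ω) X) (ν k s y X) := Iff.rfl

/-- The admissible class is closed under differences. [folklore] -/
theorem evalAdm_sub {H₁ H₂ : Bg → C.Dom → ℝ} (h₁ : H₁ ∈ EvalAdm F ν w bg) (h₂ : H₂ ∈ EvalAdm F ν w bg) :
    H₁ - H₂ ∈ EvalAdm F ν w bg := by
  intro k s y X hX
  have h := (h₁ k s y X hX).sub (h₂ k s y X hX)
  refine h.congr (Filter.Eventually.of_forall fun ω => ?_)
  simp only [Pi.sub_apply]
  ring

/-- `AdmissibleTerms` for an evaluation channel: the window's term collections are integrable along the families (displayed)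
and the class is linear (proved). [folklore] -/
theorem admissibleTerms_eval {E : Functional C Bg} {W : Set (ℕ → ℝ)} (hE : ∀ g ∈ W, E g ∈ EvalAdm F ν w bg) :
    AdmissibleTerms E W (EvalAdm F ν w bg) :=
  ⟨hE, fun _ h₁ _ h₂ => evalAdm_sub h₁ h₂⟩

/-- `AdmRestrict` for an evaluation channel: scale restrictions and truncations of an admissible collection are admissible (the
integrand is either unchanged or zero, domain by domain). [folklore] -/
theorem admRestrict_eval : AdmRestrict (C := C) (EvalAdm F ν w bg) := by
  refine ⟨fun H hH j k s y X hX => ?_, fun H hH m k s y X hX => ?_⟩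
  · by_cases hj : C.scale X = j
    · exact (hH k s y X hX).congr (Filter.Eventually.of_forall fun ω => by
        simp only [restrictScale_of_eq H hj])
    · refine (integrable_zero _ _ _).congr (Filter.Eventually.of_forall fun ω => ?_)
      simp only [restrictScale_of_ne H hj, mul_zero, Pi.zero_apply]
  · by_cases hm : C.scale X ≤ m
    · exact (hH k s y X hX).congr (Filter.Eventually.of_forall fun ω => by
        simp only [truncScale, if_pos hm])
    · refine (integrable_zero _ _ _).congr (Filter.Eventually.of_forall fun ω => ?_)
      simp only [truncScale, if_neg hm, mul_zero, Pi.zero_apply]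

/-- **`ChannelAdditive` for an evaluation channel (kernel)**: linearity of the integral on the admissible class — the printed
STRUCTURE «(1.33) is a sum of term-by-term operations» is a THEOREM for this form. [folklore] -/
theorem channelAdditive_eval : ChannelAdditive (EvalAdm F ν w bg) (evalChannel F ν w bg) := by
  intro k s H₁ h₁ H₂ h₂ y
  simp only [evalChannel]
  rw [← Finset.sum_sub_distrib]
  refine Finset.sum_congr rfl fun X hX => ?_
  rw [← integral_sub (h₁ k s y X hX) (h₂ k s y X hX)]
  refine integral_congr_ae (Filter.Eventually.of_forall fun ω => ?_)
  simp only [Pi.sub_apply]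
  ring

/-- **`ChannelLocal` for an evaluation channel (kernel)**: if every source domain of the step-k channel has creation step ≤ k
([I] (0.23) p. 256: the old action at step k consists of the terms created at steps ≤ k), the channel reads only the
truncation `truncScale k H`. [folklore] -/
theorem channelLocal_eval (hF : ∀ k s y, ∀ X ∈ F k s y, C.scale X ≤ k) :
    ChannelLocal (EvalAdm F ν w bg) (evalChannel F ν w bg) := by
  intro k s H _ y
  simp only [evalChannel]
  refine Finset.sum_congr rfl fun X hX => ?_
  refine integral_congr_ae (Filter.Eventually.of_forall fun ω => ?_)
  simp only [truncScale, if_pos (hF k s y X hX)]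

/-- `ChannelStepSum` for a local evaluation channel (by the lineage's `channelStepSum_of_local`). [folklore] -/
theorem channelStepSum_eval (hF : ∀ k s y, ∀ X ∈ F k s y, C.scale X ≤ k) :
    ChannelStepSum (EvalAdm F ν w bg) (evalChannel F ν w bg) :=
  channelStepSum_of_local admRestrict_eval channelAdditive_eval (channelLocal_eval hF)

/-! ## §2 The per-creation-step size bound from ONE kernel-mass inequality -/

/-- Elementary: `|∫ w·f dν| ≤ (∫|w| dν)·B` when `|f| ≤ B` pointwise and `w` is integrable. [folklore] -/
theorem abs_integral_mul_le_mass {μ : Measure Ω} {wt : Ω → ℝ} {f : Ω → ℝ} {B : ℝ} (hw : Integrable wt μ)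
    (hf : ∀ ω, |f ω| ≤ B) : |∫ ω, wt ω * f ω ∂μ| ≤ (∫ ω, |wt ω| ∂μ) * B := by
  have h1 : |∫ ω, wt ω * f ω ∂μ| ≤ ∫ ω, |wt ω| * B ∂μ := by
    rw [← Real.norm_eq_abs]
    refine norm_integral_le_of_norm_le (hw.abs.mul_const B) (Filter.Eventually.of_forall fun ω => ?_)
    rw [Real.norm_eq_abs, abs_mul]
    exact mul_le_mul_of_nonneg_left (hf ω) (abs_nonneg _)
  rwa [integral_mul_const] at h1

/-- **`ChannelSizeAtStepNN` FROM ONE KERNEL-MASS INEQUALITY (kernel; the theorem of this leaf).**  For an evaluation channel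
with integrable weights, if at every step `k`, creation step `j ≤ k`, comparison history `s` and output index `y` the DECAY-
WEIGHTED MASS of the weights over the source domains of creation step `j` is at most `wt k y·τ k j` —
`Σ_{X ∈ F k s y, scale X = j} e^{−κd(X)}·∫|w k s y X ω| ∂ν ≤ wt k y·τ k j` (DISPLAYED; TYPE: [II] (1.24) p. 7 = weight mass × term
size, the E₀-free sums (1.25)–(1.28), and the pre-summation factor p. 8 l. 9–10 «(6L)⁴L^jη» ↔ `τ k j`) — then a term collection
supported at creation step `j` with `|H U X| ≤ e^{−κd(X)}·N` (`N ≥ 0`) has channel output `|T k s H y| ≤ wt k y·(τ k j·N)`.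
[cite: Balaban1988RG2Cluster, (1.24) p.7, (1.25)-(1.28) pp.7-8, p.8 l.9-10, (1.36) p.9] -/
theorem channelSizeAtStepNN_of_kernelMass {κ : ℝ} {wt : ℕ → ι → ℝ} {τ : ℕ → ℕ → ℝ}
    (hw : ∀ k s y, ∀ X ∈ F k s y, Integrable (w k s y X) (ν k s y X))
    (hmass : ∀ (k j : ℕ) (s : ℕ → ℝ) (y : ι),
      ∑ X ∈ (F k s y).filter (fun X => C.scale X = j),
          Real.exp (-(κ * C.d X)) * ∫ ω, |w k s y X ω| ∂(ν k s y X) ≤ wt k y * τ k j) :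
    ChannelSizeAtStepNN (EvalAdm F ν w bg) (evalChannel F ν w bg) κ wt τ := by
  intro k j _ s H _ hsupp N hN hbd y
  simp only [evalChannel]
  -- split the source domains by creation step: off step j the integrand vanishes
  have hsplit : ∑ X ∈ F k s y, ∫ ω, w k s y X ω * H (bg k s y X ω) X ∂(ν k s y X) =
      ∑ X ∈ (F k s y).filter (fun X => C.scale X = j), ∫ ω, w k s y X ω * H (bg k s y X ω) X ∂(ν k s y X) := by
    rw [Finset.sum_filter]
    refine Finset.sum_congr rfl fun X _ => ?_
    by_cases hX : C.scale X = j
    · rw [if_pos hX]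
    · rw [if_neg hX]
      have h0 : (fun ω => w k s y X ω * H (bg k s y X ω) X) = fun _ => 0 := by
        funext ω; rw [hsupp _ X hX, mul_zero]
      rw [h0, integral_zero]
  rw [hsplit]
  calc |∑ X ∈ (F k s y).filter (fun X => C.scale X = j), ∫ ω, w k s y X ω * H (bg k s y X ω) X ∂(ν k s y X)|
      ≤ ∑ X ∈ (F k s y).filter (fun X => C.scale X = j), |∫ ω, w k s y X ω * H (bg k s y X ω) X ∂(ν k s y X)| :=
        Finset.abs_sum_le_sum_abs _ _
    _ ≤ ∑ X ∈ (F k s y).filter (fun X => C.scale X = j),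
          (∫ ω, |w k s y X ω| ∂(ν k s y X)) * (Real.exp (-(κ * C.d X)) * N) := by
        refine Finset.sum_le_sum fun X hX => ?_
        obtain ⟨hXF, hXj⟩ := Finset.mem_filter.1 hX
        exact abs_integral_mul_le_mass (hw k s y X hXF) (fun ω => hbd _ X hXj)
    _ = (∑ X ∈ (F k s y).filter (fun X => C.scale X = j),
          Real.exp (-(κ * C.d X)) * ∫ ω, |w k s y X ω| ∂(ν k s y X)) * N := by
        rw [Finset.sum_mul]
        refine Finset.sum_congr rfl fun X _ => ?_
        ring
    _ ≤ wt k y * τ k j * N := mul_le_mul_of_nonneg_right (hmass k j s y) hN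
    _ = wt k y * (τ k j * N) := by ring

/-- The weighted class-level size bound for a local evaluation channel with the kernel-mass inequality (by the lineage's
`channelSizeNN_of_perStepNN`). [folklore] -/
theorem channelSizeNN_eval {κ : ℝ} {wt : ℕ → ι → ℝ} {τ : ℕ → ℕ → ℝ}
    (hF : ∀ k s y, ∀ X ∈ F k s y, C.scale X ≤ k)
    (hw : ∀ k s y, ∀ X ∈ F k s y, Integrable (w k s y X) (ν k s y X))
    (hmass : ∀ (k j : ℕ) (s : ℕ → ℝ) (y : ι),
      ∑ X ∈ (F k s y).filter (fun X => C.scale X = j),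
          Real.exp (-(κ * C.d X)) * ∫ ω, |w k s y X ω| ∂(ν k s y X) ≤ wt k y * τ k j) :
    ChannelSizeNN (EvalAdm F ν w bg) (evalChannel F ν w bg) κ wt τ :=
  channelSizeNN_of_perStepNN admRestrict_eval (channelStepSum_eval hF) (channelSizeAtStepNN_of_kernelMass hw hmass)

/-! ## §3 End-to-end on the recursion side: the five channel binders replaced -/

/-- **NE9 ∧ FADING MEMORY WITH AN EVALUATION–INTEGRAL CHANNEL (kernel end-to-end, recursion side).**  The lineage's most-reduced
recursion-side theorem `T4HistoryLipschitzRecursion.ne9_and_fadingMemory_of_perStepNN` with its five channel binders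
(`AdmissibleTerms`, `AdmRestrict`, `ChannelAdditive`, `ChannelStepSum`, `ChannelSizeAtStepNN`) REPLACED by: the window's terms
integrable along the evaluation families (`hE`), source domains of creation step ≤ k (`hF`), integrable weights (`hw`), and the
KERNEL-MASS inequality (`hmass`).  Remaining displayed: `ScaleZeroFree` (STRUCTURE (0.23)), `OuterLipschitz` (the new-term side:
last coupling + output, supplied downstream by `outerLipschitz_of_factorisation` ∘ …), scalars.  Conclusion as there:
`NE9 E W κ (prodModuli ℓ fun _ => ω + c̄τ̄) ∧ FadingMemory (ℓ/(ω + c̄τ̄)) (ω + c̄τ̄) (…)`.  Nothing of [I]–[III] asserted.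
[cite: Balaban1988RG2Cluster, (1.23)-(1.24) p.7, p.8 l.9-10, (1.33)-(1.36) p.9; Balaban1987RG1, (0.23) p.256, (2.13) p.268] -/
theorem ne9_and_fadingMemory_of_evalChannel {E : Functional C Bg} {W : Set (ℕ → ℝ)} {κ : ℝ} {wt : ℕ → ι → ℝ}
    {τ : ℕ → ℕ → ℝ} {lam cΦ : ℕ → ℝ} {ℓ cbar τbar ω : ℝ}
    (h0 : ScaleZeroFree E W) (hE : ∀ g ∈ W, E g ∈ EvalAdm F ν w bg)
    (hF : ∀ k s y, ∀ X ∈ F k s y, C.scale X ≤ k)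
    (hw : ∀ k s y, ∀ X ∈ F k s y, Integrable (w k s y X) (ν k s y X))
    (hmass : ∀ (k j : ℕ) (s : ℕ → ℝ) (y : ι),
      ∑ X ∈ (F k s y).filter (fun X => C.scale X = j),
          Real.exp (-(κ * C.d X)) * ∫ ω, |w k s y X ω| ∂(ν k s y X) ≤ wt k y * τ k j)
    (hout : OuterLipschitz E W (evalChannel F ν w bg) κ wt lam cΦ)
    (hℓ : 0 ≤ ℓ) (hc : 0 ≤ cbar) (hτbar : 0 ≤ τbar) (hω : 0 ≤ ω) (hpos : 0 < ω + cbar * τbar)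
    (hlam : ∀ k, lam k ≤ ℓ) (hcΦ : ∀ k, 0 ≤ cΦ k ∧ cΦ k ≤ cbar)
    (hτ : ∀ k j, j ≤ k → 0 ≤ τ k j ∧ τ k j ≤ τbar * ω ^ (k - j)) :
    NE9 E W κ (prodModuli ℓ fun _ => ω + cbar * τbar) ∧
      FadingMemory (ℓ / (ω + cbar * τbar)) (ω + cbar * τbar) (prodModuli ℓ fun _ => ω + cbar * τbar) :=
  ne9_and_fadingMemory_of_perStepNN h0 (admissibleTerms_eval hE) admRestrict_eval channelAdditive_eval
    (channelStepSum_eval hF) (channelSizeAtStepNN_of_kernelMass hw hmass) hout hℓ hc hτbar hω hpos hlam hcΦ hτ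

/-! ## §4 Non-vacuity: the lineage's toy channel is an evaluation channel -/

/-- The toy channel of `T4HistoryLipschitzRecursion` §5–§7 (`toyChannel k s H () = H () k`: read the term created at step k, on
the toy carriers `Dom = ℕ`, `scale = id`, backgrounds `Unit`) IS the evaluation channel with ONE source domain `{k}`, the Dirac
parameter measure on `Unit`, weight `1`, background `()`. [folklore] -/
theorem toyChannel_eq_evalChannel :
    toyChannel = evalChannel (C := toyCarriers) (Ω := Unit) (fun k _ _ => ({k} : Finset ℕ))
      (fun _ _ _ _ => Measure.dirac ()) (fun _ _ _ _ _ => (1 : ℝ)) (fun _ _ _ _ _ => ()) := by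
  funext k s H y
  simp [toyChannel, evalChannel]

/-- The toy channel's kernel mass: at step `k` the decay-weighted mass over source domains of creation step `j` is `[j = k]`
(decay rate `κ = 0`, weight `wt ≡ 1`), so `hmass` holds with `τ k j = if j = k then 1 else 0` — the memoryless profile of the
sibling's `toy_perStep`. [folklore] -/
theorem toy_kernelMass (k j : ℕ) (y : Unit) :
    ∑ X ∈ (({k} : Finset ℕ)).filter (fun X => (toyCarriers).scale X = j),
        Real.exp (-((0 : ℝ) * (toyCarriers).d X)) * ∫ _ω, |(1 : ℝ)| ∂(Measure.dirac ()) ≤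
      (fun (_ : ℕ) (_ : Unit) => (1 : ℝ)) k y * (fun k j : ℕ => if j = k then (1 : ℝ) else 0) k j := by
  by_cases hj : j = k
  · subst hj
    have hf : (({j} : Finset ℕ)).filter (fun X => (toyCarriers).scale X = j) = {j} := by
      ext X; simp [toyCarriers]
    rw [hf, Finset.sum_singleton]
    simp
  · have hf : (({k} : Finset ℕ)).filter (fun X => (toyCarriers).scale X = j) = ∅ := by
      ext X
      simp only [Finset.mem_filter, Finset.mem_singleton, Finset.notMem_empty, iff_false, not_and]
      rintro rfl
      change ¬ X = j
      exact fun h => hj h.symm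
    rw [hf, Finset.sum_empty]
    simp [hj]

end Summit.QuantumFields.BalabanUV.T4Continuum.NE9EvaluationChannel

end
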